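import Summits.KontsevichZagierPeriods.KontsevichZagierPeriods.Theorems.TerasomaMultiplicationMultiplicationAccessibleCornerGraphRepsGen
import Mathlib.Analysis.SpecialFunctions.Pow.Continuity

/-!
# `MultiplicationAccessible` (stmt-KontsevichZagierPeriods-12305), line `shifted-family-prime-sieve`:
analysis of the exceptional-face component `Vy` of the corner Stokes on the closed `y`-band (all `p`)

Dimension `p = n + 2`, `w = (θ₁, …, θ_{n+1}, y, v)`, `u = Fin.init w`, weights `Θ₀ = 1 − Σθ_i`,
`Θ_{i+1} = θ_i`, `t_k = T u k = 1 − yΘ_k`, `Z = (∏ t_k)^(1/p)`, `S = Σ_{j<p} (−1)^j y^j e_{j+1}(Θ)`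
(`y·S = 1 − ∏ t_k`), `H = (Σ_{j<p} Z^j)/S`, `K = (∏Θ_k)^(s−1)`, `M_k = t_k^x ∏_j t_{k+j+1}^(x+(j+1)/p−1)`,
`P = v^(px−1)(1 − vZ)^(ps−1) H^(ps) K`, `Vy = P · Σ_k Θ_k M_k`.  Registered stub `cornerYFactsGen`
(analysis input of the exceptional-face move `cornerYGen`): on the CLOSED `y`-band
`Wc = {θ_i > 0, Σθ_i < 1, 0 < v < 1, 0 ≤ y, yΘ_k ≤ 1}`, `Vy` is `ℚ`-semialgebraic (composite of
polynomials, rational powers of non-negative polynomials, one quotient by `S > 0`: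
`y·S = 1 − ∏t_k ≥ 1 − t₀ > 0` for `y > 0`, `S = e₁(Θ) = 1` at `y = 0`), continuous along the closed
`y`-fibres (non-negative exponents, denominator `S > 0`), zero at the far end of a fibre (`t_k = 0`
kills every `M_j`), and at `y = 0` (`t ≡ 1`, `M ≡ 1`, `Z = 1`,
`S = 1`, `H = p`) equal to the Beta × Dirichlet face density
`p·v^(px−1)(1−v)^(ps−1) · p^(ps−1)((1 − Σθ)∏θ_i)^(s−1)`.  Dimension-`p` version of
`CornerY.isSemialgebraicFunOn_c2`, `CornerY.fibre_continuousOn/zero/top`.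
References: Kontsevich–Zagier 2001 §1.2 rule (3); Bochnak–Coste–Roy 1998 Prop. 2.2.6.
-/

noncomputable section

open MeasureTheory Set Real
open Literature.NumberTheory.Transcendental
open Literature.ModelTheory.ExponentialFields (IsSemialgebraic isSemialgebraic_setOf_eval_pos
  isSemialgebraic_setOf_eval_lt isSemialgebraic_setOf_eval_le)
open MvPolynomial (aeval X C)

namespace Summit.KontsevichZagierPeriods.TerasomaMultiplication.MultiplicationAccessible

namespace CornerYFacts

variable {n : ℕ}

/-- **`S = 1` at `y = 0`**: only the `j = 0` term `e₁(Θ) = Σ_k Θ_k = 1` of `S` survives.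
[folklore] -/
theorem S_eq_one {Θ : (Fin (n + 2) → ℝ) → Fin (n + 2) → ℝ} {S : (Fin (n + 2) → ℝ) → ℝ}
    (hΘ0 : ∀ u, Θ u 0 = 1 - ∑ i : Fin (n + 1), u (Fin.castSucc i)) (hΘs : ∀ u (i : Fin (n + 1)), Θ u i.succ = u (Fin.castSucc i))
    (hS : ∀ u, S u = ∑ j ∈ Finset.range (n + 2), (-1:ℝ) ^ j * u (Fin.last (n + 1)) ^ j *
      ∑ A ∈ Finset.powersetCard (j + 1) (Finset.univ : Finset (Fin (n + 2))), ∏ k ∈ A, Θ u k)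
    {u : Fin (n + 2) → ℝ} (hy : u (Fin.last (n + 1)) = 0) : S u = 1 := by
  rw [hS, Finset.sum_range_succ', hy, Finset.sum_eq_zero fun j _ => by
    rw [zero_pow (Nat.succ_ne_zero j), mul_zero, zero_mul], zero_add, pow_zero, pow_zero, one_mul,
    one_mul, Finset.powersetCard_one, Finset.sum_map, ← CornerGraphGen.sum_theta hΘ0 hΘs u]
  exact Finset.sum_congr rfl fun k _ => Finset.prod_singleton _ _

/-- **Signs on the closed band**, read on `u = (θ, y)` with `θ_i > 0`, `Σθ_i < 1`, `0 ≤ y`,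
`yΘ₀ ≤ 1`, `yθ_i ≤ 1`: every `Θ_k > 0`, every `t_k = 1 − yΘ_k ∈ [0, 1]`, `S > 0` (for `y > 0`
Vieta `y·S = 1 − ∏ t_k` with `∏ t_k ≤ t₀ < 1`; at `y = 0`, `S = 1`) and `Z ∈ [0, 1]`. [folklore] -/
theorem band_facts {Θ T : (Fin (n + 2) → ℝ) → Fin (n + 2) → ℝ} {Z S : (Fin (n + 2) → ℝ) → ℝ}
    (hΘ0 : ∀ u, Θ u 0 = 1 - ∑ i : Fin (n + 1), u (Fin.castSucc i)) (hΘs : ∀ u (i : Fin (n + 1)), Θ u i.succ = u (Fin.castSucc i))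
    (hT : ∀ u k, T u k = 1 - u (Fin.last (n + 1)) * Θ u k) (hZ : ∀ u, Z u = (∏ k, T u k) ^ (1 / ((n:ℝ) + 2)))
    (hS : ∀ u, S u = ∑ j ∈ Finset.range (n + 2), (-1:ℝ) ^ j * u (Fin.last (n + 1)) ^ j *
      ∑ A ∈ Finset.powersetCard (j + 1) (Finset.univ : Finset (Fin (n + 2))), ∏ k ∈ A, Θ u k)
    {u : Fin (n + 2) → ℝ} (hpos : ∀ i : Fin (n + 1), 0 < u (Fin.castSucc i))
    (hsum : ∑ i : Fin (n + 1), u (Fin.castSucc i) < 1) (hy : 0 ≤ u (Fin.last (n + 1)))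
    (h0 : u (Fin.last (n + 1)) * (1 - ∑ i : Fin (n + 1), u (Fin.castSucc i)) ≤ 1)
    (hi : ∀ i : Fin (n + 1), u (Fin.last (n + 1)) * u (Fin.castSucc i) ≤ 1) :
    (∀ k, 0 < Θ u k) ∧ (∀ k, 0 ≤ T u k ∧ T u k ≤ 1) ∧ 0 < S u ∧ (0 ≤ Z u ∧ Z u ≤ 1) := by
  have hΘ : ∀ k, 0 < Θ u k ∧ u (Fin.last (n + 1)) * Θ u k ≤ 1 := by
    refine Fin.cases ?_ (fun i => ?_)
    · rw [hΘ0]; exact ⟨by linarith, h0⟩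
    · rw [hΘs]; exact ⟨hpos i, hi i⟩
  have ht : ∀ k, 0 ≤ T u k ∧ T u k ≤ 1 := fun k => by
    rw [hT]
    have := mul_nonneg hy (hΘ k).1.le
    exact ⟨by linarith [(hΘ k).2], by linarith⟩
  have hP0 : 0 ≤ ∏ k, T u k := Finset.prod_nonneg fun k _ => (ht k).1
  have hP1 : ∏ k, T u k ≤ 1 := Finset.prod_le_one (fun k _ => (ht k).1) fun k _ => (ht k).2
  refine ⟨fun k => (hΘ k).1, ht, ?_, by
    rw [hZ]; exact ⟨rpow_nonneg hP0 _, rpow_le_one hP0 hP1 (by positivity)⟩⟩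
  rcases hy.lt_or_eq with hy' | hy'
  · have hlt : ∏ k, T u k < 1 := by
      rw [Fin.prod_univ_succ]
      refine (mul_le_of_le_one_right (ht 0).1
        (Finset.prod_le_one (fun i _ => (ht _).1) fun i _ => (ht _).2)).trans_lt ?_
      rw [hT]
      linarith [mul_pos hy' (hΘ 0).1]
    have hyS : u (Fin.last (n + 1)) * S u = 1 - ∏ k, T u k := by
      rw [CornerGraphGen.prod_T_eq hT hS u]
      ring
    exact pos_of_mul_pos_right (by rw [hyS]; linarith) hy
  · rw [S_eq_one hΘ0 hΘs hS hy'.symm]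
    exact one_pos

/-- **Values at the exceptional face `y = 0`**: `t_k = 1`, so `M_k = 1`, `Z = 1`,
`H = (Σ_{j<p} 1)/1 = p`; and `∏_k Θ_k = (1 − Σθ_i)·∏_i θ_i`. [folklore] -/
theorem face_values {x : ℚ} {Θ T M : (Fin (n + 2) → ℝ) → Fin (n + 2) → ℝ} {Z S H : (Fin (n + 2) → ℝ) → ℝ}
    (hΘ0 : ∀ u, Θ u 0 = 1 - ∑ i : Fin (n + 1), u (Fin.castSucc i)) (hΘs : ∀ u (i : Fin (n + 1)), Θ u i.succ = u (Fin.castSucc i))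
    (hT : ∀ u k, T u k = 1 - u (Fin.last (n + 1)) * Θ u k) (hZ : ∀ u, Z u = (∏ k, T u k) ^ (1 / ((n:ℝ) + 2)))
    (hS : ∀ u, S u = ∑ j ∈ Finset.range (n + 2), (-1:ℝ) ^ j * u (Fin.last (n + 1)) ^ j *
      ∑ A ∈ Finset.powersetCard (j + 1) (Finset.univ : Finset (Fin (n + 2))), ∏ k ∈ A, Θ u k)
    (hH : ∀ u, H u = (∑ j ∈ Finset.range (n + 2), Z u ^ j) / S u)
    (hM : ∀ u k, M u k = (T u k) ^ (x:ℝ) * ∏ j : Fin (n + 1), (T u (k + j.succ)) ^ ((x:ℝ) + (((j:ℕ):ℝ) + 1) / ((n:ℝ) + 2) - 1))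
    {u : Fin (n + 2) → ℝ} (hy : u (Fin.last (n + 1)) = 0) :
    (∀ k, M u k = 1) ∧ Z u = 1 ∧ H u = (n:ℝ) + 2 ∧
      ∏ k, Θ u k = (1 - ∑ i : Fin (n + 1), u (Fin.castSucc i)) * ∏ i : Fin (n + 1), u (Fin.castSucc i) := by
  have hT1 : ∀ k, T u k = 1 := fun k => by rw [hT, hy]; ring
  have hZ1 : Z u = 1 := by rw [hZ]; simp only [hT1, Finset.prod_const_one, Real.one_rpow]
  refine ⟨fun k => ?_, hZ1, ?_, ?_⟩
  · rw [hM]; simp only [hT1, Real.one_rpow, Finset.prod_const_one, mul_one]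
  · rw [hH, hZ1, S_eq_one hΘ0 hΘs hS hy, div_one]
    simp only [one_pow, Finset.sum_const, Finset.card_range, nsmul_eq_mul, mul_one]
    push_cast
    ring
  · rw [Fin.prod_univ_succ, hΘ0]
    simp only [hΘs]

/-- **A vanishing box coordinate kills every cyclic monomial**: if `t_l = 0` then every `M_k = 0`
(`t_l` occurs in `M_k` with the non-zero exponent `x` if `l = k`, and `x + (j+1)/p − 1 > 0` for
`l = k + j.succ` otherwise). [folklore] -/
theorem M_eq_zero {x : ℚ} (hx : 2 ≤ x) {T M : (Fin (n + 2) → ℝ) → Fin (n + 2) → ℝ}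
    (hM : ∀ u k, M u k = (T u k) ^ (x:ℝ) * ∏ j : Fin (n + 1), (T u (k + j.succ)) ^ ((x:ℝ) + (((j:ℕ):ℝ) + 1) / ((n:ℝ) + 2) - 1))
    {u : Fin (n + 2) → ℝ} {l : Fin (n + 2)} (hl : T u l = 0) (k : Fin (n + 2)) : M u k = 0 := by
  have hxR : (2:ℝ) ≤ x := by exact_mod_cast hx
  rw [hM]
  by_cases hlk : l = k
  · rw [← hlk, hl, Real.zero_rpow (ne_of_gt (by linarith)), zero_mul]
  · obtain ⟨j, hj⟩ := Fin.exists_succ_eq.mpr (sub_ne_zero.mpr hlk)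
    refine mul_eq_zero_of_right _ (Finset.prod_eq_zero (Finset.mem_univ j) ?_)
    have : (0:ℝ) ≤ (((j:ℕ):ℝ) + 1) / ((n:ℝ) + 2) := by positivity
    rw [hj, add_sub_cancel, hl]
    exact Real.zero_rpow (ne_of_gt (by linarith))

/-- The closed `y`-band `Wc` is `ℚ`-semialgebraic (finite intersection of polynomial
inequalities). [folklore] -/
theorem isSemialgebraic_Wc (n : ℕ) :
    IsSemialgebraic ℚ {w : Fin (n + 3) → ℝ | (∀ i : Fin (n + 1), 0 < w (Fin.castSucc (Fin.castSucc i))) ∧ ∑ i : Fin (n + 1), w (Fin.castSucc (Fin.castSucc i)) < 1 ∧ 0 < w (Fin.last (n + 2)) ∧ w (Fin.last (n + 2)) < 1 ∧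
      0 ≤ w (Fin.castSucc (Fin.last (n + 1))) ∧ w (Fin.castSucc (Fin.last (n + 1))) * (1 - ∑ i : Fin (n + 1), w (Fin.castSucc (Fin.castSucc i))) ≤ 1 ∧ ∀ i : Fin (n + 1), w (Fin.castSucc (Fin.last (n + 1))) * w (Fin.castSucc (Fin.castSucc i)) ≤ 1} := by
  have pos := fun p : MvPolynomial (Fin (n + 3)) ℚ => isSemialgebraic_setOf_eval_pos (k := ℚ) (R := ℝ) p
  have lt := fun p q : MvPolynomial (Fin (n + 3)) ℚ => isSemialgebraic_setOf_eval_lt (k := ℚ) (R := ℝ) p q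
  have le := fun p q : MvPolynomial (Fin (n + 3)) ℚ => isSemialgebraic_setOf_eval_le (k := ℚ) (R := ℝ) p q
  have hA := IsSemialgebraic.biInter Finset.univ _ fun (i : Fin (n + 1)) _ =>
    pos (X (Fin.castSucc (Fin.castSucc i)))
  have hG := IsSemialgebraic.biInter Finset.univ _ fun (i : Fin (n + 1)) _ =>
    le (X (Fin.castSucc (Fin.last (n + 1))) * X (Fin.castSucc (Fin.castSucc i))) 1
  convert (((((hA.inter (lt (∑ i : Fin (n + 1), X (Fin.castSucc (Fin.castSucc i))) 1)).inter
    (pos (X (Fin.last (n + 2))))).inter (lt (X (Fin.last (n + 2))) 1)).inter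
    (le 0 (X (Fin.castSucc (Fin.last (n + 1)))))).inter (le (X (Fin.castSucc (Fin.last (n + 1))) *
    (1 - ∑ i : Fin (n + 1), X (Fin.castSucc (Fin.castSucc i)))) 1)).inter hG using 1
  ext w
  simp only [map_sum, map_sub, map_mul, map_one, map_zero, MvPolynomial.aeval_X, mem_setOf_eq,
    mem_inter_iff, mem_iInter, Finset.mem_univ, iInter_true]
  tauto

/-- **`Vy` is `ℚ`-semialgebraic** on every `ℚ`-semialgebraic set on which the box coordinates are
non-negative, `S > 0`, `v > 0`, `1 − vZ > 0` and `∏Θ > 0`: an explicit composite of polynomials,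
rational powers (`IsSemialgebraicFunOn.rpow_ratCast(_of_nonneg)`) and one quotient.
[folklore] -/
theorem isSemialgebraicFunOn_Vy {x s : ℚ} (hx : 2 ≤ x)
    {Θ T : (Fin (n + 2) → ℝ) → Fin (n + 2) → ℝ} {Z S H K : (Fin (n + 2) → ℝ) → ℝ}
    {M : (Fin (n + 2) → ℝ) → Fin (n + 2) → ℝ} {P Vy : (Fin (n + 3) → ℝ) → ℝ}
    (hΘ0 : ∀ u, Θ u 0 = 1 - ∑ i : Fin (n + 1), u (Fin.castSucc i)) (hΘs : ∀ u (i : Fin (n + 1)), Θ u i.succ = u (Fin.castSucc i))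
    (hT : ∀ u k, T u k = 1 - u (Fin.last (n + 1)) * Θ u k) (hZ : ∀ u, Z u = (∏ k, T u k) ^ (1 / ((n:ℝ) + 2)))
    (hS : ∀ u, S u = ∑ j ∈ Finset.range (n + 2), (-1:ℝ) ^ j * u (Fin.last (n + 1)) ^ j *
      ∑ A ∈ Finset.powersetCard (j + 1) (Finset.univ : Finset (Fin (n + 2))), ∏ k ∈ A, Θ u k)
    (hH : ∀ u, H u = (∑ j ∈ Finset.range (n + 2), Z u ^ j) / S u) (hK : ∀ u, K u = (∏ k, Θ u k) ^ ((s:ℝ) - 1))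
    (hM : ∀ u k, M u k = (T u k) ^ (x:ℝ) * ∏ j : Fin (n + 1), (T u (k + j.succ)) ^ ((x:ℝ) + (((j:ℕ):ℝ) + 1) / ((n:ℝ) + 2) - 1))
    (hP : ∀ w, P w = (w (Fin.last (n + 2))) ^ (((n:ℝ) + 2) * (x:ℝ) - 1) *
      (1 - w (Fin.last (n + 2)) * Z (Fin.init w)) ^ (((n:ℝ) + 2) * (s:ℝ) - 1) * H (Fin.init w) ^ (((n:ℝ) + 2) * (s:ℝ)) * K (Fin.init w))
    (hVy : ∀ w, Vy w = P w * ∑ k, Θ (Fin.init w) k * M (Fin.init w) k)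
    {A : Set (Fin (n + 3) → ℝ)} (hA : IsSemialgebraic ℚ A)
    (hA' : ∀ w ∈ A, (∀ k, 0 ≤ T (Fin.init w) k) ∧ 0 < S (Fin.init w) ∧ 0 < w (Fin.last (n + 2)) ∧
      0 < 1 - w (Fin.last (n + 2)) * Z (Fin.init w) ∧ 0 < ∏ k, Θ (Fin.init w) k) :
    IsSemialgebraicFunOn ℚ A Vy := by
  have one : IsSemialgebraicFunOn ℚ A (fun _ : Fin (n + 3) → ℝ => (1:ℝ)) :=
    isSemialgebraicFunOn_const_of_isAlgebraic hA isAlgebraic_one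
  have cy := isSemialgebraicFunOn_apply hA (Fin.castSucc (Fin.last (n + 1)))
  have cv := isSemialgebraicFunOn_apply hA (Fin.last (n + 2))
  have hΘ : ∀ k, IsSemialgebraicFunOn ℚ A (fun w => Θ (Fin.init w) k) := by
    refine Fin.cases ?_ (fun i => ?_)
    · have hsum := IsSemialgebraicFunOn.fun_finsetSum Finset.univ hA
        (F := fun (i : Fin (n + 1)) (w : Fin (n + 3) → ℝ) => w (Fin.castSucc (Fin.castSucc i)))
        fun i _ => isSemialgebraicFunOn_apply hA _
      exact (one.fun_sub hsum).congr fun w _ => by rw [hΘ0]; rfl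
    · exact (isSemialgebraicFunOn_apply hA (Fin.castSucc (Fin.castSucc i))).congr fun w _ => by
        rw [hΘs]; rfl
  have hTk : ∀ k, IsSemialgebraicFunOn ℚ A (fun w => T (Fin.init w) k) := fun k =>
    (one.fun_sub (cy.fun_mul (hΘ k))).congr fun w _ => by rw [hT]; rfl
  have pw : ∀ (k : Fin (n + 2)) (e : ℚ), e ≠ 0 →
      IsSemialgebraicFunOn ℚ A (fun w => T (Fin.init w) k ^ ((e : ℚ) : ℝ)) := fun k e he =>
    (hTk k).rpow_ratCast_of_nonneg (fun w hw => (hA' w hw).1 k) he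
  have ex0 : (x : ℚ) ≠ 0 := ne_of_gt (by linarith)
  have exj : ∀ j : Fin (n + 1), (x + (((j:ℕ):ℚ) + 1) / ((n:ℚ) + 2) - 1 : ℚ) ≠ 0 := fun j => by
    have : (0:ℚ) ≤ (((j:ℕ):ℚ) + 1) / ((n:ℚ) + 2) := by positivity
    exact ne_of_gt (by linarith)
  have hMk : ∀ k, IsSemialgebraicFunOn ℚ A (fun w => M (Fin.init w) k) := fun k =>
    ((pw k x ex0).fun_mul (IsSemialgebraicFunOn.fun_finsetProd Finset.univ hA fun j _ =>
      pw (k + Fin.succ j) _ (exj j))).congr fun w _ => by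
        rw [hM]; push_cast; rfl
  have hPT : IsSemialgebraicFunOn ℚ A (fun w => ∏ k, T (Fin.init w) k) :=
    IsSemialgebraicFunOn.fun_finsetProd Finset.univ hA fun k _ => hTk k
  have hZ' : IsSemialgebraicFunOn ℚ A (fun w => Z (Fin.init w)) :=
    (hPT.rpow_ratCast_of_nonneg (fun w hw => Finset.prod_nonneg fun k _ => (hA' w hw).1 k)
      (show (1 / ((n:ℚ) + 2) : ℚ) ≠ 0 by positivity)).congr fun w _ => by
        rw [hZ]; push_cast; ring_nf
  have hS' : IsSemialgebraicFunOn ℚ A (fun w => S (Fin.init w)) := by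
    refine (IsSemialgebraicFunOn.fun_finsetSum (Finset.range (n + 2)) hA fun j _ =>
      ((one.fun_neg.fun_pow j).fun_mul (cy.fun_pow j)).fun_mul
        (IsSemialgebraicFunOn.fun_finsetSum (Finset.powersetCard (j + 1) Finset.univ) hA
          fun B _ => IsSemialgebraicFunOn.fun_finsetProd B hA fun k _ => hΘ k)).congr
      fun w _ => ?_
    rw [hS]
    rfl
  have hH' : IsSemialgebraicFunOn ℚ A (fun w => H (Fin.init w)) :=
    ((IsSemialgebraicFunOn.fun_finsetSum (Finset.range (n + 2)) hA fun j _ => hZ'.fun_pow j).div hS'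
      fun w hw => (hA' w hw).2.1.ne').congr fun w _ => by rw [hH]
  have hHpos : ∀ w ∈ A, 0 < H (Fin.init w) := fun w hw => by
    rw [hH]
    refine div_pos ?_ (hA' w hw).2.1
    have hZ0 : 0 ≤ Z (Fin.init w) := by
      rw [hZ]
      exact rpow_nonneg (Finset.prod_nonneg fun k _ => (hA' w hw).1 k) _
    rw [Finset.sum_range_succ', pow_zero]
    exact add_pos_of_nonneg_of_pos (Finset.sum_nonneg fun j _ => pow_nonneg hZ0 _) one_pos
  have hHp : IsSemialgebraicFunOn ℚ A (fun w => H (Fin.init w) ^ (((n:ℝ) + 2) * (s:ℝ))) :=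
    (hH'.rpow_ratCast hA hHpos (((n:ℚ) + 2) * s)).congr fun w _ => by push_cast; ring_nf
  have hK' : IsSemialgebraicFunOn ℚ A (fun w => K (Fin.init w)) :=
    ((IsSemialgebraicFunOn.fun_finsetProd Finset.univ hA fun k _ => hΘ k).rpow_ratCast hA
      (fun w hw => (hA' w hw).2.2.2.2) (s - 1)).congr fun w _ => by rw [hK]; push_cast; ring_nf
  have vp : IsSemialgebraicFunOn ℚ A
      (fun w : Fin (n + 3) → ℝ => w (Fin.last (n + 2)) ^ (((n:ℝ) + 2) * (x:ℝ) - 1)) :=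
    (cv.rpow_ratCast hA (fun w hw => (hA' w hw).2.2.1) (((n:ℚ) + 2) * x - 1)).congr fun w _ => by
      push_cast; ring_nf
  have gp : IsSemialgebraicFunOn ℚ A
      (fun w => (1 - w (Fin.last (n + 2)) * Z (Fin.init w)) ^ (((n:ℝ) + 2) * (s:ℝ) - 1)) :=
    ((one.fun_sub (cv.fun_mul hZ')).rpow_ratCast hA (fun w hw => (hA' w hw).2.2.2.1)
      (((n:ℚ) + 2) * s - 1)).congr fun w _ => by push_cast; ring_nf
  have pP : IsSemialgebraicFunOn ℚ A P :=
    (((vp.fun_mul gp).fun_mul hHp).fun_mul hK').congr fun w _ => by rw [hP]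
  exact (pP.fun_mul (IsSemialgebraicFunOn.fun_finsetSum Finset.univ hA fun k _ =>
    (hΘ k).fun_mul (hMk k))).congr fun w _ => by rw [hVy]

/-- **Continuity of `Vy` along the `y`-fibres** inside any set on which `S ∘ init > 0`: along a
fibre the weights `Θ_k` and `v` are constant, `t_k = 1 − aΘ_k`, every real power has a non-negative
exponent (`x ≥ 2`, `s ≥ 3`) and the only denominator is `S`. [folklore] -/
theorem continuousOn_fibre {x s : ℚ} (hx : 2 ≤ x) (hs : 3 ≤ s)
    {Θ T : (Fin (n + 2) → ℝ) → Fin (n + 2) → ℝ} {Z S H K : (Fin (n + 2) → ℝ) → ℝ}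
    {M : (Fin (n + 2) → ℝ) → Fin (n + 2) → ℝ} {P Vy : (Fin (n + 3) → ℝ) → ℝ}
    (hΘ0 : ∀ u, Θ u 0 = 1 - ∑ i : Fin (n + 1), u (Fin.castSucc i)) (hΘs : ∀ u (i : Fin (n + 1)), Θ u i.succ = u (Fin.castSucc i))
    (hT : ∀ u k, T u k = 1 - u (Fin.last (n + 1)) * Θ u k) (hZ : ∀ u, Z u = (∏ k, T u k) ^ (1 / ((n:ℝ) + 2)))
    (hS : ∀ u, S u = ∑ j ∈ Finset.range (n + 2), (-1:ℝ) ^ j * u (Fin.last (n + 1)) ^ j *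
      ∑ A ∈ Finset.powersetCard (j + 1) (Finset.univ : Finset (Fin (n + 2))), ∏ k ∈ A, Θ u k)
    (hH : ∀ u, H u = (∑ j ∈ Finset.range (n + 2), Z u ^ j) / S u) (hK : ∀ u, K u = (∏ k, Θ u k) ^ ((s:ℝ) - 1))
    (hM : ∀ u k, M u k = (T u k) ^ (x:ℝ) * ∏ j : Fin (n + 1), (T u (k + j.succ)) ^ ((x:ℝ) + (((j:ℕ):ℝ) + 1) / ((n:ℝ) + 2) - 1))
    (hP : ∀ w, P w = (w (Fin.last (n + 2))) ^ (((n:ℝ) + 2) * (x:ℝ) - 1) *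
      (1 - w (Fin.last (n + 2)) * Z (Fin.init w)) ^ (((n:ℝ) + 2) * (s:ℝ) - 1) * H (Fin.init w) ^ (((n:ℝ) + 2) * (s:ℝ)) * K (Fin.init w))
    (hVy : ∀ w, Vy w = P w * ∑ k, Θ (Fin.init w) k * M (Fin.init w) k)
    {A : Set (Fin (n + 3) → ℝ)} (hSA : ∀ w ∈ A, 0 < S (Fin.init w)) (w : Fin (n + 3) → ℝ) :
    ContinuousOn (fun a => Vy (Function.update w (Fin.castSucc (Fin.last (n + 1)) : Fin (n + 3)) a))
      {a | Function.update w (Fin.castSucc (Fin.last (n + 1)) : Fin (n + 3)) a ∈ A} := by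
  have hxR : (2:ℝ) ≤ x := by exact_mod_cast hx
  have hsR : (3:ℝ) ≤ s := by exact_mod_cast hs
  have hn : (0:ℝ) ≤ n := n.cast_nonneg
  have hθa : ∀ (a : ℝ) (i : Fin (n + 1)), Function.update w (Fin.castSucc (Fin.last (n + 1))) a
      (Fin.castSucc (Fin.castSucc i)) = w (Fin.castSucc (Fin.castSucc i)) := fun a i =>
    Function.update_of_ne (fun h => (Fin.castSucc_lt_last i).ne (Fin.castSucc_injective _ h)) _ _
  have hva : ∀ a : ℝ, Function.update w (Fin.castSucc (Fin.last (n + 1))) a (Fin.last (n + 2)) =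
      w (Fin.last (n + 2)) :=
    fun a => Function.update_of_ne (Fin.castSucc_lt_last _).ne' _ _
  have hya : ∀ a : ℝ, Fin.init (Function.update w (Fin.castSucc (Fin.last (n + 1))) a)
      (Fin.last (n + 1)) = a := fun a => by simp [Fin.init]
  have hΘa : ∀ (a : ℝ) (k : Fin (n + 2)),
      Θ (Fin.init (Function.update w (Fin.castSucc (Fin.last (n + 1))) a)) k = Θ (Fin.init w) k := by
    intro a k
    refine Fin.cases ?_ (fun i => ?_) k
    · rw [hΘ0, hΘ0]
      simp only [Fin.init, hθa]
    · rw [hΘs, hΘs]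
      exact hθa a i
  have hTa : ∀ (a : ℝ) (k : Fin (n + 2)),
      T (Fin.init (Function.update w (Fin.castSucc (Fin.last (n + 1))) a)) k =
        1 - a * Θ (Fin.init w) k := by
    intro a k
    rw [hT, hya, hΘa]
  have cT : ∀ k, Continuous fun a : ℝ =>
      T (Fin.init (Function.update w (Fin.castSucc (Fin.last (n + 1))) a)) k := fun k => by
    simp only [hTa]
    fun_prop
  have cM : ∀ k, Continuous fun a : ℝ =>
      M (Fin.init (Function.update w (Fin.castSucc (Fin.last (n + 1))) a)) k := fun k => by
    simp only [hM]
    refine ((cT k).rpow_const fun _ => Or.inr (by linarith)).mul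
      (continuous_finsetProd _ fun j _ => (cT _).rpow_const fun _ => Or.inr ?_)
    have : (0:ℝ) ≤ (((j:ℕ):ℝ) + 1) / ((n:ℝ) + 2) := by positivity
    linarith
  have cZ : Continuous fun a : ℝ =>
      Z (Fin.init (Function.update w (Fin.castSucc (Fin.last (n + 1))) a)) := by
    simp only [hZ]
    exact (continuous_finsetProd _ fun k _ => cT k).rpow_const fun _ => Or.inr (by positivity)
  have cS : Continuous fun a : ℝ =>
      S (Fin.init (Function.update w (Fin.castSucc (Fin.last (n + 1))) a)) := by
    simp only [hS, hya, hΘa]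
    fun_prop
  have cH : ContinuousOn (fun a : ℝ =>
      H (Fin.init (Function.update w (Fin.castSucc (Fin.last (n + 1))) a)))
      {a | Function.update w (Fin.castSucc (Fin.last (n + 1)) : Fin (n + 3)) a ∈ A} := by
    simp only [hH]
    exact (continuous_finsetSum _ fun j _ => cZ.pow j).continuousOn.div cS.continuousOn
      fun a ha => (hSA (Function.update w (Fin.castSucc (Fin.last (n + 1))) a) ha).ne'
  have cP : ContinuousOn (fun a : ℝ => P (Function.update w (Fin.castSucc (Fin.last (n + 1))) a))
      {a | Function.update w (Fin.castSucc (Fin.last (n + 1)) : Fin (n + 3)) a ∈ A} := by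
    simp only [hP, hva, hK, hΘa]
    refine ((continuousOn_const.mul ?_).mul (cH.rpow_const fun a _ => Or.inr (by nlinarith))).mul
      continuousOn_const
    exact ((continuous_const.sub (continuous_const.mul cZ)).rpow_const
      fun _ => Or.inr (by nlinarith)).continuousOn
  simp only [hVy]
  refine cP.mul (continuous_finsetSum _ fun k _ => ?_).continuousOn
  simp only [hΘa]
  exact continuous_const.mul (cM k)

end CornerYFacts

/-- **Analysis of `Vy` on the closed `y`-band, all `p`** (registered stub `cornerYFactsGen` of the
general-`p` corner Stokes assembly): the exceptional-face component `Vy = P · Σ_k Θ_k M_k` is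
`ℚ`-semialgebraic on the closed band `Wc`, continuous on the closed `y`-fibres `[0, b]`, zero at
`y = b` (some `t_k = 0` ⇒ all `M_j = 0`), and has the FACE VALUE at `y = 0` (`T ≡ 1`, `Z = 1`,
`S = 1`, `H = p`): `Vy = p·v^{px−1}(1−v)^{ps−1}·p^{ps−1}((1 − Σθ)∏θ_i)^{s−1}`, the Beta × Dirichlet
density of the exceptional face (templates: `cornerStokesYFibre`, `cornerFaceLimitThree`).
[folklore] -/
theorem cornerYFactsGen : ∀ (n : ℕ) (x s : ℚ), 2 ≤ x → 3 ≤ s → ∀ (Θ T : (Fin (n + 2) → ℝ) → Fin (n + 2) → ℝ) (Z S H K : (Fin (n + 2) → ℝ) → ℝ)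
      (M : (Fin (n + 2) → ℝ) → Fin (n + 2) → ℝ) (P : (Fin (n + 3) → ℝ) → ℝ),
    (∀ u, Θ u 0 = 1 - ∑ i : Fin (n + 1), u (Fin.castSucc i)) → (∀ u (i : Fin (n + 1)), Θ u i.succ = u (Fin.castSucc i)) →
    (∀ u k, T u k = 1 - u (Fin.last (n + 1)) * Θ u k) →
    (∀ u, Z u = (∏ k, T u k) ^ (1 / ((n:ℝ) + 2))) →
    (∀ u, S u = ∑ j ∈ Finset.range (n + 2), (-1:ℝ) ^ j * u (Fin.last (n + 1)) ^ j *
      ∑ A ∈ Finset.powersetCard (j + 1) (Finset.univ : Finset (Fin (n + 2))), ∏ k ∈ A, Θ u k) →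
    (∀ u, H u = (∑ j ∈ Finset.range (n + 2), Z u ^ j) / S u) →
    (∀ u, K u = (∏ k, Θ u k) ^ ((s:ℝ) - 1)) →
    (∀ u k, M u k = (T u k) ^ (x:ℝ) * ∏ j : Fin (n + 1), (T u (k + j.succ)) ^ ((x:ℝ) + (((j:ℕ):ℝ) + 1) / ((n:ℝ) + 2) - 1)) →
    (∀ w, P w = (w (Fin.last (n + 2))) ^ (((n:ℝ) + 2) * (x:ℝ) - 1) *
      (1 - w (Fin.last (n + 2)) * Z (Fin.init w)) ^ (((n:ℝ) + 2) * (s:ℝ) - 1) * H (Fin.init w) ^ (((n:ℝ) + 2) * (s:ℝ)) * K (Fin.init w)) →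
    ∀ (Vy : (Fin (n + 3) → ℝ) → ℝ), (∀ w, Vy w = P w * ∑ k, Θ (Fin.init w) k * M (Fin.init w) k) →
    ∀ (Wc : Set (Fin (n + 3) → ℝ)),
    Wc = {w : Fin (n + 3) → ℝ | (∀ i : Fin (n + 1), 0 < w (Fin.castSucc (Fin.castSucc i))) ∧ ∑ i : Fin (n + 1), w (Fin.castSucc (Fin.castSucc i)) < 1 ∧ 0 < w (Fin.last (n + 2)) ∧ w (Fin.last (n + 2)) < 1 ∧
      0 ≤ w (Fin.castSucc (Fin.last (n + 1))) ∧ w (Fin.castSucc (Fin.last (n + 1))) * (1 - ∑ i : Fin (n + 1), w (Fin.castSucc (Fin.castSucc i))) ≤ 1 ∧ ∀ i : Fin (n + 1), w (Fin.castSucc (Fin.last (n + 1))) * w (Fin.castSucc (Fin.castSucc i)) ≤ 1} →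
    IsSemialgebraicFunOn ℚ Wc Vy ∧
    (∀ w ∈ Wc, ContinuousOn (fun a => Vy (Function.update w (Fin.castSucc (Fin.last (n + 1)) : Fin (n + 3)) a)) {a | Function.update w (Fin.castSucc (Fin.last (n + 1)) : Fin (n + 3)) a ∈ Wc}) ∧
    (∀ w ∈ Wc, (w (Fin.castSucc (Fin.last (n + 1))) * (1 - ∑ i : Fin (n + 1), w (Fin.castSucc (Fin.castSucc i))) = 1 ∨ ∃ i : Fin (n + 1), w (Fin.castSucc (Fin.last (n + 1))) * w (Fin.castSucc (Fin.castSucc i)) = 1) → Vy w = 0) ∧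
    (∀ w ∈ Wc, w (Fin.castSucc (Fin.last (n + 1))) = 0 →
      Vy w = (((n:ℝ) + 2) * (w (Fin.last (n + 2))) ^ (((n:ℝ) + 2) * (x:ℝ) - 1) * (1 - w (Fin.last (n + 2))) ^ (((n:ℝ) + 2) * (s:ℝ) - 1)) *
        (((n:ℝ) + 2) ^ (((n:ℝ) + 2) * (s:ℝ) - 1) * ((1 - ∑ i : Fin (n + 1), w (Fin.castSucc (Fin.castSucc i))) * ∏ i : Fin (n + 1), w (Fin.castSucc (Fin.castSucc i))) ^ ((s:ℝ) - 1))) := by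
  intro n x s hx hs Θ T Z S H K M P hΘ0 hΘs hT hZ hS hH hK hM hP Vy hVy Wc hWc
  subst hWc
  refine ⟨?_, ?_, ?_, ?_⟩
  · -- (A) semialgebraicity on the closed band
    refine CornerYFacts.isSemialgebraicFunOn_Vy hx hΘ0 hΘs hT hZ hS hH hK hM hP hVy
      (CornerYFacts.isSemialgebraic_Wc n) fun w hw => ?_
    obtain ⟨hpos, hsum, hv0, hv1, hy, h0, hi⟩ := hw
    obtain ⟨hΘ, ht, hSp, hz⟩ :=
      CornerYFacts.band_facts hΘ0 hΘs hT hZ hS (u := Fin.init w) hpos hsum hy h0 hi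
    refine ⟨fun k => (ht k).1, hSp, hv0, ?_, Finset.prod_pos fun k _ => hΘ k⟩
    have := mul_le_mul_of_nonneg_left hz.2 hv0.le
    linarith
  · -- (B) continuity along the closed fibres
    refine fun w _ => CornerYFacts.continuousOn_fibre hx hs hΘ0 hΘs hT hZ hS hH hK hM hP hVy
      (fun w' hw' => ?_) w
    obtain ⟨hpos, hsum, -, -, hy, h0, hi⟩ := hw'
    exact (CornerYFacts.band_facts hΘ0 hΘs hT hZ hS (u := Fin.init w') hpos hsum hy h0 hi).2.2.1
  · -- (C) the far end of a fibre: some `t_l = 0`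
    intro w _ hend
    obtain ⟨l, hl⟩ : ∃ l, T (Fin.init w) l = 0 := by
      rcases hend with h | ⟨i, h⟩
      · refine ⟨0, ?_⟩
        rw [hT, hΘ0]
        simp only [Fin.init]
        linarith
      · refine ⟨i.succ, ?_⟩
        rw [hT, hΘs]
        simp only [Fin.init]
        linarith
    rw [hVy, Finset.sum_eq_zero fun k _ => by rw [CornerYFacts.M_eq_zero hx hM hl k, mul_zero],
      mul_zero]
  · -- (D) the face value at `y = 0`
    intro w _ hy0
    have hy0' : Fin.init w (Fin.last (n + 1)) = 0 := hy0
    obtain ⟨hM1, hZ1, hH1, hprod⟩ := CornerYFacts.face_values hΘ0 hΘs hT hZ hS hH hM hy0'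
    have hsum1 : ∑ k, Θ (Fin.init w) k * M (Fin.init w) k = 1 := by
      rw [← CornerGraphGen.sum_theta hΘ0 hΘs (Fin.init w)]
      exact Finset.sum_congr rfl fun k _ => by rw [hM1 k, mul_one]
    have hp : (0:ℝ) < (n:ℝ) + 2 := by positivity
    have hpow : ((n:ℝ) + 2) ^ (((n:ℝ) + 2) * (s:ℝ)) =
        ((n:ℝ) + 2) * ((n:ℝ) + 2) ^ (((n:ℝ) + 2) * (s:ℝ) - 1) := by
      rw [Real.rpow_sub_one hp.ne']
      field_simp
    rw [hVy, hsum1, mul_one, hP, hZ1, hH1, hK, hprod, hpow, mul_one]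
    simp only [Fin.init]
    ring

end Summit.KontsevichZagierPeriods.TerasomaMultiplication.MultiplicationAccessible

end
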